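import Summits.HodgeConjecture.CorCM.Model.ProdSection
import Summits.HodgeConjecture.CorCM.Model.TopTraceUnit
import Summits.HodgeConjecture.HodgeConjecture.Theorems.CorCMDominationCommonField
import Literature.AlgebraicGeometry.HodgeTheory.ComplexGysin
import HarnessLib

/-!
# COR-CM model layer: domination in dimension `0`, a CM type on every CM field, and the pointwise form
# of the tree-level M14

Cell `pub-hodgecm2` (COR-CM), seat `b24`.  Three small inputs of the GUARDED form of row M14
`Fact_cmDominated` for model universes whose CM flag is intrinsic (the second model `Model2.universe₂`,
`CorCM/Model/Universe2*.lean`), needed once the unguarded domination binder `hDom` is known to be false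
(`Model.not_hDom`, `CorCM/Model/CMDominationGuard.lean`) and the guarded one (`0 < A.dim`) is used instead:

* `Model.pull_eq_id_of_dim_zero`: for `X` smooth projective of dimension `0`, every endomorphism acts as the
  identity on `H•(X(ℂ); ℚ)` (`H⁰ = ℚ · 1` of the path-connected `X(ℂ)`, pull-backs fix `1`; `Hᵏ = 0` for `k > 0`);
* `Domination.isDominatedBy_of_dim_zero`: such an `X` is dominated (`Domination.IsDominatedBy`, `N = 1`) by
  EVERY smooth projective `P`, through the constant morphisms `X → Spec ℂ → P`, `P → Spec ℂ → X` at complex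
  points (both have points: `connectedSpace_complexPoints`);
* `nonempty_cmType`: every CM field carries a CM type (choose in each pair `{φ, φ̄}`, `φ ≠ φ̄` since a CM field
  is totally complex, the embedding with the smaller index in a fixed enumeration);
* `Domination.cmDominated_of_isIsogenous_coded`: the POINTWISE form of `Domination.cmDominated_of_isOfCMType`
  (whose universal hypothesis `hDom` is refutable): a complex abelian variety isogenous to the interpretation of a
  CM-flagged Picard–CM code is dominated, as an abelian variety, by `∏_j A_{(F,Θ_j)}` over a Galois CM field `F`
  of degree `≥ 6`.

KERNEL; no definition, no named fact.  References: G. Shimura, *Abelian Varieties with Complex Multiplication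
and Modular Functions* (1998), §5.1, §6.1 Cor. of Thm. 2, §6.2 Thm. 3, §18.2 Lemma; A. Hatcher, *Algebraic
Topology* (2002), §3.1.
-/

noncomputable section

open CategoryTheory MonoidalCategory NumberField
open Literature.AlgebraicGeometry.Motives
open Literature.AlgebraicGeometry.HodgeTheory
open Literature.AlgebraicGeometry.ComplexMultiplication (Shimura1998_Thm3_isogenousPower Shimura1998_Thm2_Cor)
open Literature.NumberTheory.Automorphic
open Literature.NumberTheory.Automorphic.PicardCM (BallQuotientUniformisedDatum CMAbelianVarietyRealised)

namespace Summit.HodgeConjecture.CorCM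

/-! ### A CM type on every CM field -/

/-- **Every CM field carries a CM type.**  Choosing, in each pair `{φ, φ̄}` of complex-conjugate embeddings
(`φ ≠ φ̄` because a CM field is totally complex), the one with the smaller index under a fixed enumeration of
`Hom(L, ℂ)` gives a set `Φ` with `φ ∈ Φ ↔ φ̄ ∉ Φ`. [folklore] -/
theorem nonempty_cmType (L : Type) [Field L] [NumberField L] [IsCMField L] : Nonempty (CMType L) := by
  classical
  let ι : (L →+* ℂ) → ℕ := fun φ => (Fintype.equivFin (L →+* ℂ) φ).val
  have hι : Function.Injective ι := fun φ ψ h =>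
    (Fintype.equivFin (L →+* ℂ)).injective (Fin.ext h)
  refine ⟨⟨{φ | ι φ < ι (ComplexEmbedding.conjugate φ)}, fun φ => ?_⟩⟩
  have hne : ι φ ≠ ι (ComplexEmbedding.conjugate φ) := by
    intro h
    have hreal : ComplexEmbedding.IsReal φ := ComplexEmbedding.isReal_iff.2 (hι h).symm
    exact InfinitePlace.not_isReal_of_mk_isComplex (IsTotallyComplex.isComplex (InfinitePlace.mk φ)) hreal
  have hcc : ComplexEmbedding.conjugate (ComplexEmbedding.conjugate φ) = φ := star_star φ
  simp only [Set.mem_setOf_eq, hcc, not_lt]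
  omega

namespace Model

/-! ### Dimension `0`: endomorphisms act trivially on cohomology -/

/-- **In dimension `0` every endomorphism acts trivially on rational cohomology**: for `X` smooth projective
of dimension `0`, `f^* = id` on every `Hᵏ(X(ℂ); ℚ)` — on `H⁰ = ℚ · 1` (path-connected `X(ℂ)`,
`eq_smul_one_of_pathConnectedSpace_rat`) because pull-backs fix the unit class (`bettiCohomology.map_one`), and
`Hᵏ = 0` for `k > 0 = 2 dim X` (`subsingleton_complexBetti`, `ofRatClass` injective).
[cite: HatcherAT2002, §3.1 p. 199] -/
theorem pull_eq_id_of_dim_zero {X : SchemeOver ℂ} (hX : IsSmoothProjective 0 X) (f : X ⟶ X) (k : ℕ) :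
    BettiUniverse.pull f k = LinearMap.id := by
  rcases Nat.eq_zero_or_pos k with rfl | hk
  · haveI := pathConnectedSpace_complexPoints hX
    apply LinearMap.ext
    intro z
    rw [eq_smul_one_of_pathConnectedSpace_rat z, map_smul, LinearMap.id_apply]
    congr 1
    exact bettiCohomology.map_one f
  · haveI : Subsingleton (complexBetti X k) := subsingleton_complexBetti hX (by omega)
    haveI : Subsingleton (bettiCohomology X k) :=
      (ofRatClass_injective (Y := ComplexPoints X) k).subsingleton
    apply LinearMap.ext
    intro z
    exact Subsingleton.elim _ _

end Model

namespace Domination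

/-- **A smooth projective variety of dimension `0` is dominated by every smooth projective variety** (with
`N = 1`): the constant morphisms `s : X → Spec ℂ → P` and `π : P → Spec ℂ → X` at complex points (both
`X(ℂ)` and `P(ℂ)` are connected, hence non-empty) compose to an endomorphism of `X`, which acts as the identity
on `H•(X(ℂ); ℚ)` (`Model.pull_eq_id_of_dim_zero`). [folklore] -/
theorem isDominatedBy_of_dim_zero {X P : SchemeOver ℂ} (hX : IsSmoothProjective 0 X) {m : ℕ}
    (hP : IsSmoothProjective m P) : IsDominatedBy X P := by
  obtain ⟨y₀⟩ := (connectedSpace_complexPoints hP).toNonempty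
  obtain ⟨x₀⟩ := (connectedSpace_complexPoints hX).toNonempty
  refine ⟨toSpecOver X ≫ y₀, toSpecOver P ≫ x₀, 1, one_ne_zero, fun k => ?_⟩
  rw [Nat.cast_one, one_pow, one_smul]
  exact Model.pull_eq_id_of_dim_zero hX _ k

/-! ### The pointwise form of the tree-level M14 -/

/-- **M14 for a complex abelian variety isogenous to the interpretation of a CM-flagged code** (the
pointwise form of `cmDominated_of_isOfCMType`, whose universal domination hypothesis `hDom` is refutable —
`Model.not_hDom`): `A` is dominated, as an abelian variety, by `∏_j A_{(F,Θ_j)}` over a Galois CM field `F`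
of degree `≥ 6` (the common field of the code).
[cite: Shimura1998, §5.1 Props. 1, 3, 4, §6.1 Corollary of Theorem 2, §6.2 Theorem 3, §18.2 Lemma] -/
theorem cmDominated_of_isIsogenous_coded (hU : BallQuotientUniformisedDatum) (h₃ : CMAbelianVarietyRealised)
    (hd : Shimura1998_Thm3_isogenousPower) (hcor : Shimura1998_Thm2_Cor)
    {A B : AbelianVariety ℂ} {v : PicardCM.Var} (hv : PicardCM.Var.IsCMAbelianVariety h₃ v)
    (hB : B.X = PicardCM.Var.scheme hU h₃ v) (hAB : AbelianVariety.IsIsogenous A B) :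
    ∃ (F : Type) (_ : Field F) (_ : NumberField F) (_ : IsCMField F),
      IsGalois ℚ F ∧ 6 ≤ Module.finrank ℚ F ∧
        ∃ (n : ℕ) (Θ : Fin (n + 1) → CMType F), AVDominatedBy A (cmProdAV F h₃ n Θ) := by
  obtain ⟨n, Θ, h⟩ := (coded_avDominatedBy hU h₃ hd hcor v hv (leafEmbeddable_commonField v) B hB).1
  exact ⟨commonField v, inferInstance, inferInstance, inferInstance, isGalois_commonField v,
    six_le_finrank_commonField v, n, Θ, AVDominatedBy.of_isIsogenous hAB h⟩

end Domination

end Summit.HodgeConjecture.CorCM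

end
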